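import Literature.Algebra.Module.ThreeTermComplexBaseChange
import Literature.Algebra.Module.ThreeTermComplexExchangeLocus
import HarnessLib

/-!
# Cohomology and base change along a tower `A → R → B`: the base-changed window `K ⊗_A R` over `R`, its exchange
# isomorphisms, its fibre Betti numbers and ranks read over `A` (Hartshorne III 9.3 ∕ 12.11; EGA III 7.7.5 (II))

Topic `Algebra/Module`; namespace `Literature.Algebra.Module`; theorems only (no definition, named fact, instance, notation,
`sorry`; Mathlib + ★ `Algebra/Module/ThreeTermComplexBaseChange` + ★ `Algebra/Module/ThreeTermComplexExchangeLocus`). For a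
window `K⁰ —f→ K¹ —g→ K²` of modules over a commutative ring `A` the rows ★ realise the homology of `K ⊗_A B` as
`H(K ⊗ B) := (ker (g ⊗ B)).map (range (f ⊗ B)).mkQ ⊆ coker(f ⊗ B)` (Hartshorne's `Tⁱ(B)`), `g ⊗ B = LinearMap.baseChange B
g`. For an `A`-ALGEBRA `R` the base-changed window `K_R := (R ⊗ K⁰ —f⊗R→ R ⊗ K¹ —g⊗R→ R ⊗ K²)` is a window over the RING
`R`, to which every row of the series (★ 173–181: semicontinuity, exchange, Grauert, local criterion, exchange locus, Euler
characteristic, generic exchange) applies verbatim — but its outputs are phrased with `(g ⊗ R) ⊗_R B` on `B ⊗_R (R ⊗_A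
K¹)` for `R`-algebras `B`, not with `g ⊗_A B` on `B ⊗_A K¹`. This file is the DICTIONARY between the two readings along
Mathlib's `AlgebraTensorModule.cancelBaseChange : B ⊗_R (R ⊗_A K) ≃ₗ[B] B ⊗_A K` (tower `IsScalarTower A R B`), using
the kernel ∕ range transports of ★ `ThreeTermComplexExchangeLocus` (`map_cancelBaseChange_ker_baseChange`,
`map_cancelBaseChange_range_baseChange`) BY NAME, and draws the consequences:

* §1 `exists_bettiEquiv_cancelBaseChange` — `H(K_R ⊗_R B) ≃ₗ[B] H(K ⊗_A B)` canonically (`[y] ↦ [cancelBaseChange y]`);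
  `finrank_betti_baseChange_baseChange_eq` — in particular the fibre Betti number of `K_R` at a prime `𝔔` of `R`, computed
  in `R`'s dialect, is `dim_{κ(𝔔)} H(K ⊗_A κ(𝔔))`.
* §2 **`exists_bettiBaseChangeEquiv_tower`** — COHOMOLOGY AND BASE CHANGE ALONG THE TOWER: if `R ⊗_A K²` and `R ⊗_A
  coker g` are projective `R`-modules (no hypothesis over `A` itself: e.g. `R` a field, or `R = A_s` on the free locus of
  `coker g`), then for EVERY `R`-algebra `B` the canonical map `B ⊗_R H(K ⊗_A R) → H(K ⊗_A B)`, `b ⊗ [y] ↦ [b · y]`, is a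
  `B`-linear ISOMORPHISM (★ `exists_bettiBaseChangeEquiv` over the ring `R`, then §1); `finite_betti_baseChange`,
  `projective_betti_baseChange` — `H(K ⊗_A R)` is a finite, resp. (when also `R ⊗_A coker f` is projective) projective
  `R`-module (Hartshorne III 12.11 (b) over `R`); `rankAtStalk_betti_baseChange` — its rank at `𝔔 ∈ Spec R` is
  `dim_{κ(𝔔)} H(K ⊗_A κ(𝔔))`.
* §3 **`finrank_betti_baseChange_eq_of_isScalarTower`** — THE FIBRE BETTI NUMBER IS INVARIANT UNDER FIELD EXTENSION: for
  fields `κ → L` under `A`, `dim_L H(K ⊗_A L) = dim_κ H(K ⊗_A κ)`, for ANY window (over a field every module is projective,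
  so §2 applies with `R = κ`, `B = L`; Mathlib `Module.finrank_baseChange`) — Hartshorne III Prop. 9.3 (cohomology commutes
  with flat base change) for `Spec L → Spec κ`, module form; `finrank_betti_baseChange_residueField_eq_of_comap_eq` — hence
  `dim_{κ(𝔔)} H(K ⊗_A κ(𝔔)) = dim_{κ(𝔭)} H(K ⊗_A κ(𝔭))` for a prime `𝔔` of `R` over `𝔭` (Mathlib `Ideal.ResidueField.map`):
  with §1, **the Betti function of `K_R` on `Spec R` is the pull-back of the Betti function of `K` on `Spec A`** (EGA III
  7.7.5 (II) functoriality in the base, module form).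

Against the kin, BY DECL. (1) ★ `ThreeTermComplexExchangeLocus` §Transport (`cancelBaseChange_baseChange_baseChange_apply`,
`map_cancelBaseChange_ker_baseChange`, `map_cancelBaseChange_range_baseChange`, and the FLAT-`R` transport of base-changed
cycles) is imported and used BY NAME; that row transports the exchange CRITERION `φ(κ(𝔭))` from `A_𝔭` to `A`; this file
transports the realised HOMOLOGY and the exchange ISOMORPHISM along an arbitrary tower. (2) ★ `ThreeTermComplexBaseChange.
exists_bettiBaseChangeEquiv` ∕ `finite_betti` ∕ `projective_betti` (window over one ring, `K²`, `coker g` projective over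
THAT ring) are the engines of §2, applied to `K_R` over `R`; ★ `RingTheory/Flat/HomologyBaseChange.tensorQuotRangeEquiv`
(`R ⊗ coker g ≃ coker(g ⊗ R)`) converts the hypotheses. (3) ★ `RingTheory/Flat/HomologyBaseChange` §3
`tensorHomologyEquivOfSquare` is homology and FLAT base change `S ⊗_R H ≅ H'` in the subquotient model `ker g ⧸ (im f).comap
_` against an arbitrary model of `C ⊗ S` — a different hypothesis (flatness of `S`, nothing on the cokernels) and a different
model; §3 below could also be read from it (a field extension is flat) but is obtained here from §2 in the cokernel model of
rows 173–181 with the explicit formula. (4) ★ `Algebra/Module/FreeOfFibreRankEq.finrank_tensor_eq_finrank_residueField_tensor`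
(`dim_{κ'}(κ' ⊗ M) = dim_κ(κ ⊗ M)` for a surjection of a local ring onto a field) and ★
`FibreRankSemicontinuity` (fibre rank through `cancelBaseChange` over `A_𝔭`) are the MODULE (no differential) instances of the
§3 mechanism. (5) Rows `Algebra/Homology/HomologyFlatBaseChangeUnit` ∕ `QuasiIsoAtLocal` (flat base change of
`HomologicalComplex` homology in the `tensorLeft` dialect) — complexes over one ring, flat base, not a tower dictionary.
Mathlib used (pin): `AlgebraTensorModule.cancelBaseChange` (`_tmul` is `rfl`), `Submodule.Quotient.equiv`, `Submodule.mapQ_apply`,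
`Submodule.map_comp`, `LinearEquiv.ofSubmodules`, `Module.Projective.of_equiv`, `Module.finrank_baseChange`,
`Module.rankAtStalk_eq`, `Ideal.ResidueField.map` ∕ `map_algebraMap`, `IsScalarTower.of_algebraMap_eq`.

What is NOT here: leaf B — the basic-open ∕ generic exchange (`R = A_s` on the free locus of `coker g`; Görtz–Wedhorn II Thm.
23.140); (iv) constructibility of the Betti strata and (v) the `ℤ`-indexed Euler characteristic (g33 memo § NEXT); the
FLAT-`R` comparison `H(K ⊗ R) ≅ R ⊗ H(K)` (★ `HomologyBaseChange` §3, rows `QuasiIsoAtLocal` ∕ `HomologyFlatBaseChangeUnit`,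
other dialect); the scheme form; the `HomologicalComplex` reading. Library only (cell `pub-hodge-ring2`, count-neutral);
proves nothing about any crux, route or conjecture.

## References

* R. Hartshorne, *Algebraic Geometry*, GTM 52 (1977), III Prop. 9.3 (p. 255), Prop. 12.5, Thm. 12.11 (pp. 287–290; held PDF
  p0346–p0351). [Hartshorne1977]
* A. Grothendieck, EGA III₂ (1963), 7.7.5 (II), 7.7.10, 7.8.4 — not held at this pin; cited in prose as by the kin rows.
  [EGAIII2]
* D. Mumford, *Abelian Varieties* (1970), §5 Cor. 2 (p. 50) — not held at this pin; statement as cited by the kin rows, not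
  re-checked against a scan. [MumfordAV1970]
-/

universe u
open TensorProduct Module
open Literature.RingTheory.Flat (tensorQuotRangeEquiv)

namespace Literature.Algebra.Module

variable {A : Type u} [CommRing A] (R : Type u) [CommRing R] [Algebra A R] (B : Type u) [CommRing B] [Algebra A B]
  [Algebra R B] [IsScalarTower A R B]
  {K0 K1 K2 : Type u} [AddCommGroup K0] [Module A K0] [AddCommGroup K1] [Module A K1]
  [AddCommGroup K2] [Module A K2] {f : K0 →ₗ[A] K1} {g : K1 →ₗ[A] K2}

/-! ### §1 The dictionary: `H(K_R ⊗_R B) ≅ H(K ⊗_A B)` along `cancelBaseChange` -/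

section Dictionary

/-- **The realised homology of `(K ⊗_A R) ⊗_R B` is that of `K ⊗_A B`**, canonically: Mathlib's `cancelBaseChange :
B ⊗_R (R ⊗_A K¹) ≃ B ⊗_A K¹` carries `ker((g ⊗ R) ⊗_R B)` onto `ker(g ⊗ B)` and `im((f ⊗ R) ⊗_R B)` onto `im(f ⊗ B)` (★
`map_cancelBaseChange_ker_baseChange` ∕ `_range_baseChange`), hence induces, on the quotients by the ranges, a `B`-linear
isomorphism carrying `H(K_R ⊗_R B) = (ker ((g ⊗ R) ⊗ B)).map (range ((f ⊗ R) ⊗ B)).mkQ` onto `H(K ⊗_A B)`; on classes `[y]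
↦ [cancelBaseChange y]`. No hypothesis on the window (not even `g ∘ f = 0`). [cite: Hartshorne1977, III Prop. 9.3 (p. 255),
Prop. 12.5 (p. 287)] -/
theorem exists_bettiEquiv_cancelBaseChange :
    ∃ e : ↥((LinearMap.ker ((g.baseChange R).baseChange B)).map
          (LinearMap.range ((f.baseChange R).baseChange B)).mkQ) ≃ₗ[B]
        ↥((LinearMap.ker (g.baseChange B)).map (LinearMap.range (f.baseChange B)).mkQ),
      ∀ (y : B ⊗[R] (R ⊗[A] K1)) (hy : y ∈ LinearMap.ker ((g.baseChange R).baseChange B)),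
        ((e ⟨(LinearMap.range ((f.baseChange R).baseChange B)).mkQ y, Submodule.mem_map_of_mem hy⟩ :
            ↥((LinearMap.ker (g.baseChange B)).map (LinearMap.range (f.baseChange B)).mkQ)) :
            (B ⊗[A] K1) ⧸ LinearMap.range (f.baseChange B)) =
          (LinearMap.range (f.baseChange B)).mkQ (AlgebraTensorModule.cancelBaseChange A R B B K1 y) := by
  let c := AlgebraTensorModule.cancelBaseChange A R B B K1
  -- the induced isomorphism of cokernels
  let q : ((B ⊗[R] (R ⊗[A] K1)) ⧸ LinearMap.range ((f.baseChange R).baseChange B)) ≃ₗ[B]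
      ((B ⊗[A] K1) ⧸ LinearMap.range (f.baseChange B)) :=
    Submodule.Quotient.equiv _ _ c (map_cancelBaseChange_range_baseChange R B f)
  have hq : ∀ y, q (Submodule.Quotient.mk y) = Submodule.Quotient.mk (c y) := fun y => rfl
  have hcomp : (q : _ →ₗ[B] _) ∘ₗ (LinearMap.range ((f.baseChange R).baseChange B)).mkQ =
      (LinearMap.range (f.baseChange B)).mkQ ∘ₗ (c : _ →ₗ[B] _) :=
    LinearMap.ext fun y => hq y
  -- it carries `H(K_R ⊗_R B)` onto `H(K ⊗_A B)`
  have hmap : ((LinearMap.ker ((g.baseChange R).baseChange B)).map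
        (LinearMap.range ((f.baseChange R).baseChange B)).mkQ).map (q : _ →ₗ[B] _) =
      (LinearMap.ker (g.baseChange B)).map (LinearMap.range (f.baseChange B)).mkQ := by
    rw [← Submodule.map_comp, hcomp, Submodule.map_comp, ← map_cancelBaseChange_ker_baseChange R B g]
  exact ⟨q.ofSubmodules _ _ hmap, fun y hy => by rw [LinearEquiv.ofSubmodules_apply]; exact hq y⟩

/-- Hence the fibre Betti number (indeed `dim_B H` for any `B` in the tower) of the base-changed window `K ⊗_A R`,
computed in `R`'s dialect, equals `dim_B H(K ⊗_A B)`: e.g. `b^{K_R}(𝔔) = dim_{κ(𝔔)} H(K ⊗_A κ(𝔔))` at a prime `𝔔` of `R`.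
[cite: Hartshorne1977, III Prop. 9.3 (p. 255), Prop. 12.5 (p. 287)] -/
theorem finrank_betti_baseChange_baseChange_eq :
    finrank B ↥((LinearMap.ker ((g.baseChange R).baseChange B)).map
        (LinearMap.range ((f.baseChange R).baseChange B)).mkQ) =
      finrank B ↥((LinearMap.ker (g.baseChange B)).map (LinearMap.range (f.baseChange B)).mkQ) := by
  obtain ⟨e, -⟩ := exists_bettiEquiv_cancelBaseChange R B (f := f) (g := g)
  exact e.finrank_eq

end Dictionary

/-! ### §2 Cohomology and base change along the tower -/

section Exchange

variable (hfg : g ∘ₗ f = 0)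
include hfg

/-- **Cohomology and base change along a tower** (Hartshorne III Thm. 12.11 ∕ EGA III 7.7.10, 7.8.4, for the base-changed
complex `K ⊗_A R` over `R`): if `R ⊗_A K²` and `R ⊗_A coker g` are PROJECTIVE `R`-modules — nothing is assumed over `A` —
then for EVERY `R`-algebra `B` (tower `A → R → B`) the canonical map `B ⊗_R H(K ⊗_A R) → H(K ⊗_A B)`, `b ⊗ [y] ↦ [b · y]`
(`y ∈ ker(g ⊗ R)`, `b · y := cancelBaseChange (b ⊗ y) ∈ B ⊗_A K¹`), is a `B`-linear ISOMORPHISM. Proof: ★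
`exists_bettiBaseChangeEquiv` for the window `K_R` over the ring `R` (`(g ⊗ R) ∘ (f ⊗ R) = 0` is the two-line `rw` also
named ★ `KernelBaseChangeDescent.baseChange_comp_baseChange_eq_zero`; `coker(g ⊗ R) ≅ R ⊗ coker g` by ★
`tensorQuotRangeEquiv`), followed by the dictionary §1. [cite: Hartshorne1977, III Thm. 12.11 (p. 290; PDF p0351)]
[cite: MumfordAV1970, §5 Cor. 2 (p. 50)] -/
theorem exists_bettiBaseChangeEquiv_tower [Module.Projective R (R ⊗[A] K2)]
    [Module.Projective R (R ⊗[A] (K2 ⧸ LinearMap.range g))] :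
    ∃ e : B ⊗[R] ↥((LinearMap.ker (g.baseChange R)).map (LinearMap.range (f.baseChange R)).mkQ) ≃ₗ[B]
        ↥((LinearMap.ker (g.baseChange B)).map (LinearMap.range (f.baseChange B)).mkQ),
      ∀ (b : B) (y : R ⊗[A] K1) (hy : y ∈ LinearMap.ker (g.baseChange R)),
        ((e (b ⊗ₜ[R] ⟨(LinearMap.range (f.baseChange R)).mkQ y, Submodule.mem_map_of_mem hy⟩)) :
            (B ⊗[A] K1) ⧸ LinearMap.range (f.baseChange B)) =
          (LinearMap.range (f.baseChange B)).mkQ (AlgebraTensorModule.cancelBaseChange A R B B K1 (b ⊗ₜ[R] y)) := by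
  -- the window `K_R` over `R`
  have hfgR : g.baseChange R ∘ₗ f.baseChange R = 0 := by
    rw [← LinearMap.baseChange_comp, hfg, LinearMap.baseChange_zero]
  haveI : Module.Projective R ((R ⊗[A] K2) ⧸ LinearMap.range (g.baseChange R)) :=
    Module.Projective.of_equiv (tensorQuotRangeEquiv R g)
  -- exchange over `R`, then the dictionary
  obtain ⟨e₁, he₁⟩ := exists_bettiBaseChangeEquiv hfgR B
  obtain ⟨e₂, he₂⟩ := exists_bettiEquiv_cancelBaseChange R B (f := f) (g := g)
  refine ⟨e₁.trans e₂, fun b y hy => ?_⟩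
  have hmem : b ⊗ₜ[R] y ∈ LinearMap.ker ((g.baseChange R).baseChange B) := by
    rw [LinearMap.mem_ker, LinearMap.baseChange_tmul, LinearMap.mem_ker.1 hy, tmul_zero]
  have h₁ : e₁ (b ⊗ₜ[R] ⟨(LinearMap.range (f.baseChange R)).mkQ y, Submodule.mem_map_of_mem hy⟩) =
      ⟨(LinearMap.range ((f.baseChange R).baseChange B)).mkQ (b ⊗ₜ[R] y), Submodule.mem_map_of_mem hmem⟩ :=
    Subtype.ext (he₁ b y hy)
  rw [LinearEquiv.trans_apply, h₁]
  exact he₂ _ hmem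

/-- `H(K ⊗_A R)` is a FINITE `R`-module when `R ⊗ K¹` is finite and `R ⊗ K²`, `R ⊗ coker g` are projective over `R` (★
`finite_betti` over `R`: a retract of `coker(f ⊗ R)`). [cite: Hartshorne1977, III Prop. 12.4, Thm. 12.11 (pp. 287–290)] -/
theorem finite_betti_baseChange [Module.Finite R (R ⊗[A] K1)] [Module.Projective R (R ⊗[A] K2)]
    [Module.Projective R (R ⊗[A] (K2 ⧸ LinearMap.range g))] :
    Module.Finite R ↥((LinearMap.ker (g.baseChange R)).map (LinearMap.range (f.baseChange R)).mkQ) := by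
  have hfgR : g.baseChange R ∘ₗ f.baseChange R = 0 := by
    rw [← LinearMap.baseChange_comp, hfg, LinearMap.baseChange_zero]
  haveI : Module.Projective R ((R ⊗[A] K2) ⧸ LinearMap.range (g.baseChange R)) :=
    Module.Projective.of_equiv (tensorQuotRangeEquiv R g)
  exact finite_betti hfgR

/-- **Hartshorne III 12.11 (b) along the tower**: `H(K ⊗_A R)` is a PROJECTIVE `R`-module when `R ⊗ coker f`, `R ⊗ K²`
and `R ⊗ coker g` are projective over `R` (★ `projective_betti` over `R`). [cite: Hartshorne1977, III Thm. 12.11 (b) (p. 290)] -/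
theorem projective_betti_baseChange [Module.Projective R (R ⊗[A] (K1 ⧸ LinearMap.range f))]
    [Module.Projective R (R ⊗[A] K2)] [Module.Projective R (R ⊗[A] (K2 ⧸ LinearMap.range g))] :
    Module.Projective R ↥((LinearMap.ker (g.baseChange R)).map (LinearMap.range (f.baseChange R)).mkQ) := by
  have hfgR : g.baseChange R ∘ₗ f.baseChange R = 0 := by
    rw [← LinearMap.baseChange_comp, hfg, LinearMap.baseChange_zero]
  haveI : Module.Projective R ((R ⊗[A] K1) ⧸ LinearMap.range (f.baseChange R)) :=
    Module.Projective.of_equiv (tensorQuotRangeEquiv R f)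
  haveI : Module.Projective R ((R ⊗[A] K2) ⧸ LinearMap.range (g.baseChange R)) :=
    Module.Projective.of_equiv (tensorQuotRangeEquiv R g)
  exact projective_betti hfgR

/-- Under the hypotheses of the two previous statements `H(K ⊗_A R)` is finite locally free over `R`, and ITS RANK at a
prime `𝔔` of `R` is the fibre Betti number there, read over `A`: `rankAtStalk_R H(K ⊗_A R) 𝔔 = dim_{κ(𝔔)} H(K ⊗_A κ(𝔔))`
(Mathlib `Module.rankAtStalk_eq` + the exchange isomorphism of this § with `B = κ(𝔔)`). [cite: Hartshorne1977, III Cor. 12.9,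
Thm. 12.11 (pp. 288–290)] -/
theorem rankAtStalk_betti_baseChange [Module.Finite R (R ⊗[A] K1)] [Module.Projective R (R ⊗[A] (K1 ⧸ LinearMap.range f))]
    [Module.Projective R (R ⊗[A] K2)] [Module.Projective R (R ⊗[A] (K2 ⧸ LinearMap.range g))] (Q : PrimeSpectrum R) :
    Module.rankAtStalk ↥((LinearMap.ker (g.baseChange R)).map (LinearMap.range (f.baseChange R)).mkQ) Q =
      finrank Q.asIdeal.ResidueField ↥((LinearMap.ker (g.baseChange Q.asIdeal.ResidueField)).map
        (LinearMap.range (f.baseChange Q.asIdeal.ResidueField)).mkQ) := by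
  haveI := finite_betti_baseChange R hfg
  haveI := projective_betti_baseChange R hfg
  obtain ⟨e, -⟩ := exists_bettiBaseChangeEquiv_tower R Q.asIdeal.ResidueField hfg
  rw [Module.rankAtStalk_eq]
  exact e.finrank_eq

end Exchange

/-! ### §3 The fibre Betti number is invariant under field extension -/

section Fields

variable (hfg : g ∘ₗ f = 0)
include hfg

/-- **Invariance of the fibre Betti number under extension of the field** (Hartshorne III Prop. 9.3 — cohomology commutes
with flat base change — for `Spec L → Spec κ`, module form; EGA III 7.7.5 (II)): for fields `κ → L` under `A` and ANY window
`K⁰ → K¹ → K²` of `A`-modules, `dim_L H(K ⊗_A L) = dim_κ H(K ⊗_A κ)`. Over the field `κ` every module is projective, so §2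
gives `L ⊗_κ H(K ⊗ κ) ≅ H(K ⊗ L)`; then Mathlib `Module.finrank_baseChange`. (The module case `dim_{κ'}(κ' ⊗ M) = dim_κ(κ ⊗
M)` is ★ `FreeOfFibreRankEq.finrank_tensor_eq_finrank_residueField_tensor`.) [cite: Hartshorne1977, III Prop. 9.3 (p. 255)] -/
theorem finrank_betti_baseChange_eq_of_isScalarTower (κ L : Type u) [Field κ] [Field L] [Algebra A κ] [Algebra A L]
    [Algebra κ L] [IsScalarTower A κ L] :
    finrank L ↥((LinearMap.ker (g.baseChange L)).map (LinearMap.range (f.baseChange L)).mkQ) =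
      finrank κ ↥((LinearMap.ker (g.baseChange κ)).map (LinearMap.range (f.baseChange κ)).mkQ) := by
  obtain ⟨e, -⟩ := exists_bettiBaseChangeEquiv_tower κ L hfg
  rw [← e.finrank_eq, Module.finrank_baseChange]

/-- **The Betti function is compatible with change of base ring**: for an `A`-algebra `R`, a prime `𝔔` of `R` and the prime
`𝔭 = 𝔔 ∩ A` under it, `dim_{κ(𝔔)} H(K ⊗_A κ(𝔔)) = dim_{κ(𝔭)} H(K ⊗_A κ(𝔭))` (the residue field extension `κ(𝔭) → κ(𝔔)`
is Mathlib `Ideal.ResidueField.map`); with §1 `finrank_betti_baseChange_baseChange_eq`: the Betti function of `K ⊗_A R` on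
`Spec R` is the pull-back of the Betti function of `K` on `Spec A` (EGA III 7.7.5 (II), module form).
[cite: Hartshorne1977, III Prop. 9.3 (p. 255)] -/
theorem finrank_betti_baseChange_residueField_eq_of_comap_eq (Q : PrimeSpectrum R) (p : PrimeSpectrum A)
    (hQ : p.asIdeal = Q.asIdeal.comap (algebraMap A R)) :
    finrank Q.asIdeal.ResidueField ↥((LinearMap.ker (g.baseChange Q.asIdeal.ResidueField)).map
        (LinearMap.range (f.baseChange Q.asIdeal.ResidueField)).mkQ) =
      finrank p.asIdeal.ResidueField ↥((LinearMap.ker (g.baseChange p.asIdeal.ResidueField)).map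
        (LinearMap.range (f.baseChange p.asIdeal.ResidueField)).mkQ) := by
  letI : Algebra p.asIdeal.ResidueField Q.asIdeal.ResidueField :=
    (Ideal.ResidueField.map p.asIdeal Q.asIdeal (algebraMap A R) hQ).toAlgebra
  haveI : IsScalarTower A p.asIdeal.ResidueField Q.asIdeal.ResidueField :=
    IsScalarTower.of_algebraMap_eq fun a => by
      rw [RingHom.algebraMap_toAlgebra, Ideal.ResidueField.map_algebraMap, IsScalarTower.algebraMap_apply A R]
  exact finrank_betti_baseChange_eq_of_isScalarTower hfg p.asIdeal.ResidueField Q.asIdeal.ResidueField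

end Fields

end Literature.Algebra.Module
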